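import Summits.BirchSwinnertonDyer.BirchSwinnertonDyer.Theorems.CyclotomicUntwistKatzFrobeniusModVarpi
import Literature.NumberTheory.EllipticCurves.FormalGroupFrobeniusTypeProofs
import Literature.NumberTheory.EllipticCurves.FormalGroupLawAxiomsUniversalProofs
import Literature.NumberTheory.EllipticCurves.FormalGroupDictionaryProofs
import HarnessLib

/-!
# Route `CyclotomicUntwist`: the Frobenius relation `φ² − a·φ + 3 = 0` on EVERY second-kind class of a
# Weierstrass equation over `𝓞 = 𝓞_{ℚ₃(ζ₉)}` with elliptic special fibre (`φ = (z ↦ z³)^*`, `a = 4 − #Ē(𝔽₃)`)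

Cell `pub/bsd-wall` (D-0145 line `route-BirchSwinnertonDyer-CyclotomicUntwist`), prover seat `bsd-line-cycu-p3`
(gen 8), lane «KATZ FROBENIUS MOD ϖ»; sequel of `CyclotomicUntwistKatzFrobeniusModVarpi` (p632401). THEOREMS ONLY
(no definition, no named fact, no `sorry`); helper `--supports` K1 = stmt-BirchSwinnertonDyer-21580 (serves K2 =
21581 and the print child C2 = 27549 / 27616, whose cost is the Literature named fact
`WeierstrassCurve.isDescendedFrobeniusMatrix_exists`). BSD is not proved by this file and no crux is.

For `E/𝓞` whose reduction `Ē = E ⊗_ρ 𝔽₃` along `ρ : 𝓞 → 𝔽₃` is elliptic, `a = HasseManin.tr Ē = 4 − #Ē(𝔽₃)`,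
`Ĝ` its formal group law over `ℚ₃(ζ₉)`, and every `f ∈ ℚ₃(ζ₉)⟦z⟧` with `f(0) = 0`, `3ᵈ·n·[zⁿ]f ∈ 𝓞` and
`∂_Ĝ f` with `3^{d'}`-bounded denominators (a class of Katz's `D(Ê/𝓞) ⊗ ℚ`): **`f(z⁹) + 3·f − a·f(z³)` has
`3^{d+1+d'}`-bounded denominators** (`frobenius_relation`), i.e. `(φ² − aφ + 3)[f] = 0` for `φ[f] = [f(z³)]`.
Proof: the tree's characteristic-`3` identity `F̃(X⁹, [3]˜X) = [a]˜(X³)` (Manin's `π² − aπ + 3 = 0`,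
`FormalGroupFrobeniusTypeProofs.frobenius_formal_identity_of_nonneg/_of_neg`, via a coefficientwise `ℤ₃`-lift of
`Ē`, §3) makes the `𝓞`-series `Ĝ(X⁹,[3]X)` and `[a](X³)` (resp. `i([|a|](X³))`) congruent modulo `ϖ`; the Key
Lemma modulo `ϖ` gives `f` of both congruent; the cocycle calculus of a second-kind `f` on `𝓞`-integral arguments
(§1–§2: `f(Ĝ(P,Q)) ≡ f(P) + f(Q)`, `f([m]z) ≡ m·f`, `f(i(z)) ≡ −f`) evaluates both sides (§4). No `ℤ₃`-model of
`E`, no Honda theory, no Berthelot–Ogus transfer; with `f = log` and `a ∈ 3ℤ` this is the trace input `tr M = a`.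
[cite: Katz1981CrystallineDieudonne, §5 Thm 5.1.4 and (6.1.1)] [cite: SilvermanAEC2009, Thm. V.2.3.1(b)]
-/

set_option autoImplicit false
-- single-conjunct summit: `Summit.BirchSwinnertonDyer.BirchSwinnertonDyer.…` repeats the name by design
set_option linter.dupNamespace false

noncomputable section

open PowerSeries Literature.NumberTheory.EllipticCurves Literature.NumberTheory.EllipticCurves.DescendedFrobenius
  Summit.BirchSwinnertonDyer.BirchSwinnertonDyer.Theorems.DescendedFrobeniusTransfer

namespace Summit.BirchSwinnertonDyer.BirchSwinnertonDyer.Theorems.KatzFrobenius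

/-! ## §1 Bounded denominators survive `𝓞`-integral substitutions -/

/-- A series with `3ᵏ`-bounded denominators is `3⁻ᵏ` times an `𝓞`-integral series. [folklore] -/
theorem exists_integral_map_eq {σ : Type*} {Φ : MvPowerSeries σ KNine} {k : ℕ}
    (hΦ : ∀ e, IsIntegral ℤ_[3] ((3 : KNine) ^ k * MvPowerSeries.coeff e Φ)) :
    ∃ Ψ : MvPowerSeries σ ONine, Ψ.map (algebraMap ONine KNine) = (3 : KNine) ^ k • Φ := by
  refine ⟨fun e => ⟨(3 : KNine) ^ k * MvPowerSeries.coeff e Φ, hΦ e⟩, ?_⟩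
  ext e
  rw [MvPowerSeries.coeff_map, MvPowerSeries.coeff_smul]
  rfl

/-- **Substituting `𝓞`-integral series (without constant terms) preserves bounded denominators**: if `3ᵏ·Φ` is
integral then so is `3ᵏ·Φ(b)` for `b` integral. [cite: Katz1981CrystallineDieudonne, §5.1 (p. 193)] -/
theorem isIntegral_mvCoeff_subst_of_bdd {σ τ : Type*} {Φ : MvPowerSeries σ KNine} {k : ℕ}
    (hΦ : ∀ e, IsIntegral ℤ_[3] ((3 : KNine) ^ k * MvPowerSeries.coeff e Φ))
    {b : σ → MvPowerSeries τ ONine} (hb : MvPowerSeries.HasSubst b) (e : τ →₀ ℕ) :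
    IsIntegral ℤ_[3] ((3 : KNine) ^ k *
      MvPowerSeries.coeff e (MvPowerSeries.subst (fun i => (b i).map (algebraMap ONine KNine)) Φ)) := by
  obtain ⟨Ψ, hΨ⟩ := exists_integral_map_eq hΦ
  have hbK : MvPowerSeries.HasSubst (fun i => (b i).map (algebraMap ONine KNine)) := hb.map _
  rw [← MvPowerSeries.coeff_smul, ← MvPowerSeries.subst_smul hbK, ← hΨ, ← MvPowerSeries.map_subst hb,
    MvPowerSeries.coeff_map]
  exact (MvPowerSeries.coeff e (MvPowerSeries.subst b Ψ)).2

/-- `Φ(P, Q)` for `P, Q ∈ 𝓞⟦z⟧` without constant terms keeps `3ᵏ`-bounded denominators. [folklore] -/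
theorem isIntegral_coeff_subst_pair_of_bdd {Φ : MvPowerSeries (Fin 2) KNine} {k : ℕ}
    (hΦ : ∀ e, IsIntegral ℤ_[3] ((3 : KNine) ^ k * MvPowerSeries.coeff e Φ))
    {P Q : PowerSeries ONine} (hP : constantCoeff P = 0) (hQ : constantCoeff Q = 0) (n : ℕ) :
    IsIntegral ℤ_[3] ((3 : KNine) ^ k * coeff n
      (MvPowerSeries.subst ![P.map (algebraMap ONine KNine), Q.map (algebraMap ONine KNine)] Φ)) := by
  have hb : MvPowerSeries.HasSubst ![P, Q] := WeierstrassCurve.hasSubst_pair hP hQ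
  have e1 : (![P.map (algebraMap ONine KNine), Q.map (algebraMap ONine KNine)] : Fin 2 → KNine⟦X⟧) =
      fun i => (![P, Q] i).map (algebraMap ONine KNine) := by
    funext i; fin_cases i <;> rfl
  rw [e1]
  exact isIntegral_mvCoeff_subst_of_bdd hΦ hb _

/-- `g(T)` for `T ∈ 𝓞⟦z⟧` without constant term keeps `3ᵏ`-bounded denominators. [folklore] -/
theorem isIntegral_coeff_subst_of_bdd {g : KNine⟦X⟧} {k : ℕ}
    (hg : ∀ n, IsIntegral ℤ_[3] ((3 : KNine) ^ k * coeff n g))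
    {T : PowerSeries ONine} (hT : constantCoeff T = 0) (n : ℕ) :
    IsIntegral ℤ_[3] ((3 : KNine) ^ k * coeff n (g.subst (T.map (algebraMap ONine KNine)))) := by
  have hb : MvPowerSeries.HasSubst (fun _ : Unit => T) :=
    (HasSubst.of_constantCoeff_zero' hT).const
  have hΦ : ∀ e, IsIntegral ℤ_[3] ((3 : KNine) ^ k * MvPowerSeries.coeff e g) := fun e ↦ by
    have := hg (e ())
    rwa [PowerSeries.coeff_def (s := e) rfl] at this
  exact isIntegral_mvCoeff_subst_of_bdd hΦ hb _

/-- `expand` preserves `3ᵏ`-bounded denominators. [folklore] -/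
theorem isIntegral_coeff_expand_of_bdd {g : KNine⟦X⟧} {k : ℕ}
    (hg : ∀ n, IsIntegral ℤ_[3] ((3 : KNine) ^ k * coeff n g)) (q : ℕ) (hq : q ≠ 0) (n : ℕ) :
    IsIntegral ℤ_[3] ((3 : KNine) ^ k * coeff n (expand q hq g)) := by
  rw [coeff_expand]
  split_ifs
  · exact hg _
  · rw [mul_zero]; exact isIntegral_zero

/-- Weakening the bound: `3ᵏ·x` integral ⟹ `3^{j+k}·x` integral. [folklore] -/
theorem isIntegral_pow_add_mul {x : KNine} {k : ℕ} (h : IsIntegral ℤ_[3] ((3 : KNine) ^ k * x)) (j : ℕ) :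
    IsIntegral ℤ_[3] ((3 : KNine) ^ (j + k) * x) := by
  rw [pow_add, mul_assoc]; exact (isIntegral_three_pow j).mul h

/-- `constantCoeff` commutes with `map` (one variable). [folklore] -/
theorem constantCoeff_map_eq {R S : Type*} [CommRing R] [CommRing S] (φ : R →+* S) (P : R⟦X⟧) :
    constantCoeff (P.map φ) = φ (constantCoeff P) := by
  rw [← coeff_zero_eq_constantCoeff_apply, coeff_map, coeff_zero_eq_constantCoeff_apply]

/-! ## §2 Cocycle calculus of a second-kind series on `𝓞`-integral arguments -/

section Cocycle

variable (E : WeierstrassCurve ONine) (f : KNine⟦X⟧)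

/-- **`f(Ĝ(P,Q)) = f(P) + f(Q) + (∂f)(P,Q)`** — the definition of the coboundary, substituted. [folklore] -/
theorem subst_formalGroupLaw_pair_eq {P Q : KNine⟦X⟧} (hP : constantCoeff P = 0) (hQ : constantCoeff Q = 0) :
    f.subst (MvPowerSeries.subst ![P, Q] (E.map (algebraMap ONine KNine)).formalGroupLaw) =
      f.subst P + f.subst Q + MvPowerSeries.subst ![P, Q]
        (f.subst (E.map (algebraMap ONine KNine)).formalGroupLaw - f.subst (MvPowerSeries.X 0) -
          f.subst (MvPowerSeries.X 1)) := by
  have hb : MvPowerSeries.HasSubst ![P, Q] := WeierstrassCurve.hasSubst_pair hP hQ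
  rw [MvPowerSeries.subst_sub hb, MvPowerSeries.subst_sub hb,
    mvSubst_powerSeries_subst (E.map (algebraMap ONine KNine)).hasSubst_formalGroupLaw hb,
    mvSubst_powerSeries_subst (PowerSeries.HasSubst.X 0) hb, mvSubst_powerSeries_subst (PowerSeries.HasSubst.X 1) hb,
    MvPowerSeries.subst_X hb 0, MvPowerSeries.subst_X hb 1]
  simp only [Matrix.cons_val_zero, Matrix.cons_val_one]
  ring

variable {E f} {d' : ℕ}
  (hcob : ∀ e, IsIntegral ℤ_[3] ((3 : KNine) ^ d' * MvPowerSeries.coeff e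
    (f.subst (E.map (algebraMap ONine KNine)).formalGroupLaw - f.subst (MvPowerSeries.X 0) -
      f.subst (MvPowerSeries.X 1))))
include hcob

/-- **`f(Ĝ(P,Q)) ≡ f(P) + f(Q)`** modulo `3^{d'}`-bounded series (`P, Q ∈ 𝓞⟦z⟧`, no constant terms). [folklore] -/
theorem isIntegral_coeff_subst_formalGroupLaw_pair {P Q : PowerSeries ONine} (hP : constantCoeff P = 0)
    (hQ : constantCoeff Q = 0) (n : ℕ) :
    IsIntegral ℤ_[3] ((3 : KNine) ^ d' * coeff n
      (f.subst (MvPowerSeries.subst ![P.map (algebraMap ONine KNine), Q.map (algebraMap ONine KNine)]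
          (E.map (algebraMap ONine KNine)).formalGroupLaw) -
        f.subst (P.map (algebraMap ONine KNine)) - f.subst (Q.map (algebraMap ONine KNine)))) := by
  have hPK : constantCoeff (P.map (algebraMap ONine KNine)) = 0 := by rw [constantCoeff_map_eq, hP, map_zero]
  have hQK : constantCoeff (Q.map (algebraMap ONine KNine)) = 0 := by rw [constantCoeff_map_eq, hQ, map_zero]
  rw [subst_formalGroupLaw_pair_eq E f hPK hQK,
    show ∀ a b c : KNine⟦X⟧, a + b + c - a - b = c from fun a b c => by ring]
  exact isIntegral_coeff_subst_pair_of_bdd hcob hP hQ n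

/-- **`f([m]z) ≡ m·f(z)`** modulo `3^{d'}`-bounded series (`[m+1] = Ĝ([m], z)`, induction; `f(0) = 0`). [folklore] -/
theorem isIntegral_coeff_subst_formalMul_sub (hf0 : constantCoeff f = 0) (m n : ℕ) :
    IsIntegral ℤ_[3] ((3 : KNine) ^ d' * coeff n
      (f.subst ((E.map (algebraMap ONine KNine)).formalMul m) - m • f)) := by
  induction m generalizing n with
  | zero =>
    rw [WeierstrassCurve.formalMul_zero, zero_nsmul, sub_zero, PowerSeries.subst_zero_of_constantCoeff_zero hf0,
      map_zero, mul_zero]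
    exact isIntegral_zero
  | succ m ih =>
    have key := isIntegral_coeff_subst_formalGroupLaw_pair hcob (E.constantCoeff_formalMul m)
      (constantCoeff_X (R := ONine)) n
    rw [WeierstrassCurve.map_formalMul, PowerSeries.map_X, ← WeierstrassCurve.formalMul_succ,
      powerSeries_subst_X_self] at key
    have e : f.subst ((E.map (algebraMap ONine KNine)).formalMul (m + 1)) - (m + 1) • f =
        (f.subst ((E.map (algebraMap ONine KNine)).formalMul (m + 1)) -
          f.subst ((E.map (algebraMap ONine KNine)).formalMul m) - f) +
        (f.subst ((E.map (algebraMap ONine KNine)).formalMul m) - m • f) := by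
      rw [succ_nsmul]; ring
    rw [e, map_add, mul_add]
    exact key.add (ih n)

/-- **`f(i(z)) ≡ −f(z)`** modulo `3^{d'}`-bounded series (`Ĝ(z, i(z)) = 0`; `f(0) = 0`). [folklore] -/
theorem isIntegral_coeff_subst_formalNeg_add (hf0 : constantCoeff f = 0) (n : ℕ) :
    IsIntegral ℤ_[3] ((3 : KNine) ^ d' * coeff n
      (f.subst (E.map (algebraMap ONine KNine)).formalNeg + f)) := by
  have key := isIntegral_coeff_subst_formalGroupLaw_pair hcob (constantCoeff_X (R := ONine))
    E.constantCoeff_formalNeg n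
  rw [WeierstrassCurve.map_formalNeg, PowerSeries.map_X, WeierstrassCurve.formalGroupLaw_subst_X_formalNeg',
    PowerSeries.subst_zero_of_constantCoeff_zero hf0, powerSeries_subst_X_self, zero_sub] at key
  have e : f.subst (E.map (algebraMap ONine KNine)).formalNeg + f =
      -(-f - f.subst (E.map (algebraMap ONine KNine)).formalNeg) := by ring
  rw [e, map_neg, mul_neg]
  exact key.neg

end Cocycle

/-! ## §3 The characteristic-`3` identity lifted to `𝓞` modulo `ϖ` -/

/-- **Coefficientwise `ℤ₃`-lift of a curve over `𝔽₃`** (lift every `aᵢ` by its digit). [folklore] -/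
theorem exists_padicInt_lift (Ebar : WeierstrassCurve (ZMod 3)) :
    ∃ V : WeierstrassCurve ℤ_[3], V.map PadicInt.toZMod = Ebar := by
  refine ⟨⟨(Ebar.a₁.val : ℤ_[3]), (Ebar.a₂.val : ℤ_[3]), (Ebar.a₃.val : ℤ_[3]), (Ebar.a₄.val : ℤ_[3]),
    (Ebar.a₆.val : ℤ_[3])⟩, ?_⟩
  ext <;> simp [WeierstrassCurve.map]

/-- A `ℤ₃`-equation whose special fibre is an elliptic curve has elliptic generic fibre (`Δ` is a `3`-adic unit).
[cite: SilvermanAEC2009, VII.5] -/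
theorem isElliptic_map_coe_of_isElliptic_map_toZMod (V : WeierstrassCurve ℤ_[3])
    [hV : (V.map PadicInt.toZMod).IsElliptic] : (V.map PadicInt.Coe.ringHom).IsElliptic := by
  refine ⟨?_⟩
  rw [WeierstrassCurve.map_Δ, isUnit_iff_ne_zero]
  intro h0
  have hΔ : V.Δ = 0 := (PadicInt.coe_eq_zero (p := 3)).mp h0
  have h := hV.isUnit
  rw [WeierstrassCurve.map_Δ, hΔ, map_zero] at h
  exact not_isUnit_zero h

/-- **`Ĝ(X⁹, [3]X) ≡ [a](X³)` resp. `≡ i([|a|](X³))` modulo `ϖ` in `𝓞⟦X⟧`**, `a = HasseManin.tr (E ⊗_ρ 𝔽₃)`: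
the tree's characteristic-`3` identity `F̃(X⁹,[3]˜X) = [a]˜(X³)` (`frobenius_formal_identity_of_nonneg/_of_neg`,
Manin's `π² − aπ + 3 = 0`) for the elliptic curve `E ⊗_ρ 𝔽₃`, read through `ker ρ ⊆ (ϖ)`.
[cite: SilvermanAEC2009, Thm. V.2.3.1(b)] -/
theorem C_dvd_frobLHS_sub_frobRHS {ϖ : ONine} (ρ : ONine →+* ZMod 3) (hker : ∀ x : ONine, ρ x = 0 → ϖ ∣ x)
    (E : WeierstrassCurve ONine) [hE : (E.map ρ).IsElliptic] :
    (0 ≤ HasseManin.tr (E.map ρ) →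
      MvPowerSeries.C ϖ ∣ WeierstrassCurve.frobLHS 3 E -
        WeierstrassCurve.frobRHSPos 3 E (HasseManin.tr (E.map ρ)).toNat) ∧
    (HasseManin.tr (E.map ρ) < 0 →
      MvPowerSeries.C ϖ ∣ WeierstrassCurve.frobLHS 3 E -
        WeierstrassCurve.frobRHSNeg 3 E (HasseManin.tr (E.map ρ)).natAbs) := by
  obtain ⟨V, hV⟩ := exists_padicInt_lift (E.map ρ)
  haveI hVt : (V.map PadicInt.toZMod).IsElliptic := by rw [hV]; exact hE
  haveI := isElliptic_map_coe_of_isElliptic_map_toZMod V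
  -- from `(U − W).map ρ = 0` to `C ϖ ∣ U − W`
  have hdvd : ∀ {U W : ONine⟦X⟧}, (U - W).map ρ = 0 → MvPowerSeries.C ϖ ∣ U - W := by
    intro U W h
    have hc : ∀ e : Unit →₀ ℕ, ϖ ∣ MvPowerSeries.coeff e (U - W) := fun e ↦ by
      apply hker
      have := congrArg (MvPowerSeries.coeff e) h
      rwa [MvPowerSeries.coeff_zero, show PowerSeries.map ρ (U - W) = MvPowerSeries.map ρ (U - W) from rfl,
        MvPowerSeries.coeff_map] at this
    choose c hc using hc
    refine ⟨fun e ↦ c e, MvPowerSeries.ext fun e ↦ ?_⟩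
    rw [MvPowerSeries.coeff_C_mul]
    exact hc e
  constructor
  · intro ha
    have hid := WeierstrassCurve.frobenius_formal_identity_of_nonneg (p := 3) V (by norm_num) (by rwa [hV])
    rw [hV] at hid
    apply hdvd
    rw [map_sub, WeierstrassCurve.map_frobLHS 3 E ρ (by norm_num), WeierstrassCurve.map_frobRHSPos 3 E ρ (by norm_num),
      WeierstrassCurve.frobLHS, WeierstrassCurve.frobRHSPos, sub_eq_zero]
    simpa using hid
  · intro ha
    have hid := WeierstrassCurve.frobenius_formal_identity_of_neg (p := 3) V (by norm_num) (by rwa [hV])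
    rw [hV] at hid
    apply hdvd
    rw [map_sub, WeierstrassCurve.map_frobLHS 3 E ρ (by norm_num), WeierstrassCurve.map_frobRHSNeg 3 E ρ (by norm_num),
      WeierstrassCurve.frobLHS, WeierstrassCurve.frobRHSNeg, sub_eq_zero]
    simpa using hid

/-! ## §4 The relation `φ² − aφ + 3 = 0` on second-kind classes -/

section Relation

variable {ϖ θ θ' : ONine} (h3 : (3 : ONine) = ϖ ^ 6 * θ) (hθ : θ * θ' = 1) (ρ : ONine →+* ZMod 3)
  (hker : ∀ x : ONine, ρ x = 0 → ϖ ∣ x) (E : WeierstrassCurve ONine) [hE : (E.map ρ).IsElliptic]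
  {f : KNine⟦X⟧} (hf0 : constantCoeff f = 0) {d : ℕ}
  (hf : ∀ n : ℕ, IsIntegral ℤ_[3] ((3 : KNine) ^ d * ((n : KNine) * coeff n f))) {d' : ℕ}
  (hcob : ∀ e, IsIntegral ℤ_[3] ((3 : KNine) ^ d' * MvPowerSeries.coeff e
    (f.subst (E.map (algebraMap ONine KNine)).formalGroupLaw - f.subst (MvPowerSeries.X 0) -
      f.subst (MvPowerSeries.X 1))))

include hcob hf0 in
/-- **`f(Ĝ(X⁹,[3]X)) = f(z⁹) + 3f + (bounded)`**: the left side of the identity evaluated on a second-kind class.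
[cite: Katz1981CrystallineDieudonne, §5 Thm 5.1.4] -/
theorem subst_frobLHS_eq :
    ∃ β : KNine⟦X⟧, (∀ n, IsIntegral ℤ_[3] ((3 : KNine) ^ d' * coeff n β)) ∧
      f.subst ((WeierstrassCurve.frobLHS 3 E).map (algebraMap ONine KNine)) =
        expand 9 (by norm_num) f + 3 • f + β := by
  set ι := algebraMap ONine KNine with hι
  set EK := E.map ι with hEK
  have hmap : (WeierstrassCurve.frobLHS 3 E).map ι = WeierstrassCurve.frobLHS 3 EK :=
    WeierstrassCurve.map_frobLHS 3 E ι (by norm_num)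
  -- the two arguments as `𝓞`-series
  have hP : constantCoeff ((X : ONine⟦X⟧) ^ 3 ^ 2) = 0 := by
    rw [map_pow, constantCoeff_X, zero_pow (by norm_num)]
  have hQ : constantCoeff ((E.formalMul 3).subst (X : ONine⟦X⟧)) = 0 := E.constantCoeff_formalMul_subst_X 3
  have hPK : PowerSeries.map ι ((X : ONine⟦X⟧) ^ 3 ^ 2) = (X : KNine⟦X⟧) ^ 3 ^ 2 := by rw [map_pow, PowerSeries.map_X]
  have hQK : PowerSeries.map ι ((E.formalMul 3).subst (X : ONine⟦X⟧)) = EK.formalMul 3 := by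
    rw [powerSeries_subst_X_self, WeierstrassCurve.map_formalMul]
  have h1 := isIntegral_coeff_subst_formalGroupLaw_pair hcob hP hQ
  rw [hPK, hQK] at h1
  refine ⟨(f.subst (MvPowerSeries.subst ![(X : KNine⟦X⟧) ^ 3 ^ 2, EK.formalMul 3] EK.formalGroupLaw) -
      f.subst ((X : KNine⟦X⟧) ^ 3 ^ 2) - f.subst (EK.formalMul 3)) + (f.subst (EK.formalMul 3) - 3 • f),
    fun n ↦ ?_, ?_⟩
  · rw [map_add, mul_add]
    exact (h1 n).add (isIntegral_coeff_subst_formalMul_sub hcob hf0 3 n)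
  · rw [hmap, WeierstrassCurve.frobLHS, powerSeries_subst_X_self, PowerSeries.expand_apply,
      show ((X : KNine⟦X⟧) ^ 3 ^ 2) = X ^ 9 by norm_num]
    ring

include hcob hf0 in
/-- **`f([m](X³)) = m·f(z³) + (bounded)`**. [cite: Katz1981CrystallineDieudonne, §5 Thm 5.1.4] -/
theorem subst_frobRHSPos_eq (m : ℕ) :
    ∃ β : KNine⟦X⟧, (∀ n, IsIntegral ℤ_[3] ((3 : KNine) ^ d' * coeff n β)) ∧
      f.subst ((WeierstrassCurve.frobRHSPos 3 E m).map (algebraMap ONine KNine)) =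
        m • expand 3 (by norm_num) f + β := by
  set ι := algebraMap ONine KNine with hι
  set EK := E.map ι with hEK
  have hmap : (WeierstrassCurve.frobRHSPos 3 E m).map ι = WeierstrassCurve.frobRHSPos 3 EK m :=
    WeierstrassCurve.map_frobRHSPos 3 E ι (by norm_num) m
  have hX3 : PowerSeries.HasSubst ((X : KNine⟦X⟧) ^ 3) := PowerSeries.HasSubst.X_pow (by norm_num)
  set γ : KNine⟦X⟧ := f.subst (EK.formalMul m) - m • f with hγ
  have hγb : ∀ n, IsIntegral ℤ_[3] ((3 : KNine) ^ d' * coeff n γ) :=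
    isIntegral_coeff_subst_formalMul_sub hcob hf0 m
  refine ⟨expand 3 (by norm_num) γ, isIntegral_coeff_expand_of_bdd hγb 3 (by norm_num), ?_⟩
  rw [hmap, WeierstrassCurve.frobRHSPos, ← PowerSeries.subst_comp_subst_apply (EK.hasSubst_formalMul m) hX3,
    show f.subst (EK.formalMul m) = m • f + γ by rw [hγ]; ring, ← PowerSeries.expand_apply, map_add, map_nsmul]

include hcob hf0 in
/-- **`f(i([m](X³))) = −m·f(z³) + (bounded)`**. [cite: Katz1981CrystallineDieudonne, §5 Thm 5.1.4] -/
theorem subst_frobRHSNeg_eq (m : ℕ) :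
    ∃ β : KNine⟦X⟧, (∀ n, IsIntegral ℤ_[3] ((3 : KNine) ^ d' * coeff n β)) ∧
      f.subst ((WeierstrassCurve.frobRHSNeg 3 E m).map (algebraMap ONine KNine)) =
        -(m • expand 3 (by norm_num) f) + β := by
  set ι := algebraMap ONine KNine with hι
  set EK := E.map ι with hEK
  obtain ⟨β₁, hβ₁, h₁⟩ := subst_frobRHSPos_eq E hf0 hcob m
  -- `T = [m](X³)` as an `𝓞`-series
  set T := WeierstrassCurve.frobRHSPos 3 E m with hT
  have hT0 : constantCoeff T = 0 := E.constantCoeff_frobRHSPos 3 (by norm_num) m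
  have hTK0 : constantCoeff (T.map ι) = 0 := by rw [constantCoeff_map_eq, hT0, map_zero]
  have hTs : PowerSeries.HasSubst (T.map ι) := PowerSeries.HasSubst.of_constantCoeff_zero' hTK0
  have hmap : (WeierstrassCurve.frobRHSNeg 3 E m).map ι = EK.formalNeg.subst (T.map ι) := by
    rw [WeierstrassCurve.map_frobRHSNeg 3 E ι (by norm_num) m, WeierstrassCurve.frobRHSNeg,
      ← WeierstrassCurve.frobRHSPos, hT, ← WeierstrassCurve.map_frobRHSPos 3 E ι (by norm_num) m]
  set γ : KNine⟦X⟧ := f.subst EK.formalNeg + f with hγ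
  have hγb : ∀ n, IsIntegral ℤ_[3] ((3 : KNine) ^ d' * coeff n γ) :=
    isIntegral_coeff_subst_formalNeg_add hcob hf0
  refine ⟨PowerSeries.subst (T.map ι) γ - β₁, fun n ↦ ?_, ?_⟩
  · rw [map_sub, mul_sub]
    exact (isIntegral_coeff_subst_of_bdd hγb hT0 n).sub (hβ₁ n)
  · rw [hmap, ← PowerSeries.subst_comp_subst_apply
      (PowerSeries.HasSubst.of_constantCoeff_zero' EK.constantCoeff_formalNeg) hTs,
      show f.subst EK.formalNeg = γ - f by rw [hγ]; ring, PowerSeries.subst_sub hTs, h₁]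
    ring

include h3 hθ hker hf0 hf hcob in
/-- **THE FROBENIUS RELATION ON SECOND-KIND CLASSES.** For a Weierstrass equation `E/𝓞` whose reduction along
`ρ : 𝓞 → 𝔽₃` is an elliptic curve with trace `a = HasseManin.tr (E ⊗_ρ 𝔽₃) = 4 − #Ē(𝔽₃)`, and every
`f ∈ ℚ₃(ζ₉)⟦z⟧` with `f(0) = 0`, `3ᵈ·n·[zⁿ]f ∈ 𝓞` and `∂_Ĝ f` with `3^{d'}`-bounded denominators:
**`f(z⁹) + 3·f − a·f(z³)` has `3^{d+1+d'}`-bounded denominators**, i.e. `(φ² − aφ + 3)[f] = 0` in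
`D(Ê/𝓞) ⊗ ℚ` for `φ[f] = [f(z³)]` (`CyclotomicUntwistKatzFrobeniusModVarpi.coboundary_expand_three`).
[cite: Katz1981CrystallineDieudonne, §5 Thm 5.1.4 and (6.1.1)] [cite: SilvermanAEC2009, Thm. V.2.3.1(b)] -/
theorem frobenius_relation (n : ℕ) :
    IsIntegral ℤ_[3] ((3 : KNine) ^ (d + 1 + d') *
      (coeff n (expand 9 (by norm_num) f) + 3 * coeff n f -
        ((HasseManin.tr (E.map ρ) : ℤ) : KNine) * coeff n (expand 3 (by norm_num) f))) := by
  set ι := algebraMap ONine KNine with hι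
  set a := HasseManin.tr (E.map ρ) with ha
  obtain ⟨β, hβ, hL⟩ := subst_frobLHS_eq E hf0 hcob
  -- Key Lemma modulo `ϖ` applied to `U = Ĝ(X⁹,[3]X)` and the right side `W`
  have hKey : ∀ {W : ONine⟦X⟧}, constantCoeff W = 0 → MvPowerSeries.C ϖ ∣ WeierstrassCurve.frobLHS 3 E - W →
      ∀ n, IsIntegral ℤ_[3] ((3 : KNine) ^ (d + 1) * coeff n
        (f.subst ((WeierstrassCurve.frobLHS 3 E).map ι) - f.subst (W.map ι))) := by
    intro W hW0 hUW n
    have := isIntegral_three_pow_mul_mvCoeff_subst_sub_subst (σ := Unit) h3 hθ hf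
      (E.constantCoeff_frobLHS 3 (by norm_num)) hW0 hUW (Finsupp.single () n)
    rw [PowerSeries.coeff_def (s := Finsupp.single () n) (Finsupp.single_eq_same)]
    exact this
  rcases le_or_gt 0 a with hpos | hneg
  · obtain ⟨β', hβ', hR⟩ := subst_frobRHSPos_eq E hf0 hcob a.toNat
    have hdvd := (C_dvd_frobLHS_sub_frobRHS ρ hker E).1 hpos
    have hK := hKey (E.constantCoeff_frobRHSPos 3 (by norm_num) a.toNat) hdvd n
    rw [hL, hR] at hK
    -- `LHS = (f(U) − f(W)) − β + β'`
    have e : coeff n (expand 9 (by norm_num) f) + 3 * coeff n f - (a : KNine) * coeff n (expand 3 (by norm_num) f) =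
        coeff n (expand 9 (by norm_num) f + 3 • f + β - (a.toNat • expand 3 (by norm_num) f + β')) -
          coeff n β + coeff n β' := by
      have hcast : ((a.toNat : ℕ) : KNine) = (a : KNine) := by
        rw [← Int.cast_natCast, Int.toNat_of_nonneg hpos]
      simp only [map_sub, map_add, map_nsmul]
      simp only [nsmul_eq_mul, Nat.cast_ofNat, hcast]
      ring
    rw [e, mul_add, mul_sub]
    refine ((?_ : IsIntegral ℤ_[3] _).sub ?_).add ?_
    · rw [show d + 1 + d' = d' + (d + 1) by ring]; exact isIntegral_pow_add_mul hK d'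
    · exact isIntegral_pow_add_mul (hβ n) (d + 1)
    · exact isIntegral_pow_add_mul (hβ' n) (d + 1)
  · obtain ⟨β', hβ', hR⟩ := subst_frobRHSNeg_eq E hf0 hcob a.natAbs
    have hdvd := (C_dvd_frobLHS_sub_frobRHS ρ hker E).2 hneg
    have hK := hKey (E.constantCoeff_frobRHSNeg 3 (by norm_num) a.natAbs) hdvd n
    rw [hL, hR] at hK
    have e : coeff n (expand 9 (by norm_num) f) + 3 * coeff n f - (a : KNine) * coeff n (expand 3 (by norm_num) f) =
        coeff n (expand 9 (by norm_num) f + 3 • f + β - (-(a.natAbs • expand 3 (by norm_num) f) + β')) -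
          coeff n β + coeff n β' := by
      have hcast : ((a.natAbs : ℕ) : KNine) = -(a : KNine) := by
        have : ((a.natAbs : ℕ) : ℤ) = -a := by omega
        rw [← Int.cast_natCast, this, Int.cast_neg]
      simp only [map_sub, map_add, map_neg, map_nsmul]
      simp only [nsmul_eq_mul, Nat.cast_ofNat, hcast]
      ring
    rw [e, mul_add, mul_sub]
    refine ((?_ : IsIntegral ℤ_[3] _).sub ?_).add ?_
    · rw [show d + 1 + d' = d' + (d + 1) by ring]; exact isIntegral_pow_add_mul hK d'
    · exact isIntegral_pow_add_mul (hβ n) (d + 1)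
    · exact isIntegral_pow_add_mul (hβ' n) (d + 1)

end Relation

end Summit.BirchSwinnertonDyer.BirchSwinnertonDyer.Theorems.KatzFrobenius
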